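import Summits.CriticalPhenomena.SAWScalingLimit.Theorems.SAWDevelopingMapHexTransferGMHexDictionaryChart
import Summits.CriticalPhenomena.SAWScalingLimit.Theorems.SAWDevelopingMapHexTransferPortTransferPolyline
import Summits.CriticalPhenomena.SAWScalingLimit.Theorems.SAWDevelopingMapHexTransferQuarterTurnCovariance

/-!
# The `π/3` dictionary, part V: the two drawings of a walk are `2δ`-close

Helper file of the line `yb-relay` for the crux `HexTransfer` (stmt-CriticalPhenomena-14221), stub
`stub_gmHexDictionary`. For a self-avoiding walk `γ` of the canonical discretisation of the face
domain and its Yang–Baxter walk `φ γ` (`hexToYB`), the Glazman–Manolescu drawing of `φ γ` (polyline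
through the rescaled midpoints of the crossed mid-edges) and the image under the similarity
`S_δ z = i z − i δ/2` of the Duminil-Copin–Smirnov drawing of `γ` (polyline through the rescaled
triangle centres) are at distance `≤ 2δ` in `CurveClass ℂ`: both visit the same rhombi in the same
order, so after repeating vertices (which does not change the class, `mk_polyline_stay`) they become
two polylines with the same number of vertices, paired vertices lying in a common closed rescaled
rhombus, of diameter `≤ 2δ` (`dist_mk_polyline_le`). Main result: `dist_curve_hexToYB_le`.
[cite: GlazmanManolescu2019, §1 p. 3, Fig. 2]; bookkeeping tagged [folklore].
-/

noncomputable section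

namespace Summit.CriticalPhenomena.SAWScalingLimit.Cruxes.HexTransfer.YbRelay

open Set
open Complex (I)
open Literature.Probability.LatticeModels
open Literature.Probability.RandomPlanarGeometry
open Literature.Probability.RandomPlanarGeometry.SAW
open Literature.Probability.RandomPlanarGeometry.SAW.YangBaxter
open Summit.CriticalPhenomena.SAWScalingLimit.Cruxes.HexTransfer.Sketch.PortTransfer (stay dist_mk_polyline_le
  mk_polyline_stay)

/-! ### Polylines under the similarity -/

/-- The similarity `S_δ` is affine on segments. [folklore] -/
theorem gmSimilarity_lineMap (δ : ℝ) (x y : ℂ) (c : ℝ) :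
    gmSimilarity δ (AffineMap.lineMap x y c) = AffineMap.lineMap (gmSimilarity δ x) (gmSimilarity δ y) c := by
  rw [AffineMap.lineMap_apply_module, AffineMap.lineMap_apply_module, gmSimilarity_apply, gmSimilarity_apply,
    gmSimilarity_apply]
  simp only [Complex.real_smul]
  push_cast
  ring

/-- **The image under `S_δ` of a polyline class is the class of the polyline through the image
vertices.** [folklore] -/
theorem map_gmSimilarity_mk_polyline (δ : ℝ) (x : ℂ) (l : List ℂ) :
    CurveClass.map (gmSimilarity δ : C(ℂ, ℂ)) (CurveClass.mk ⟨polyline (x :: l)⟩) =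
      CurveClass.mk ⟨polyline ((x :: l).map (gmSimilarity δ))⟩ := by
  rw [CurveClass.map_mk]
  congr 1
  change (⟨(gmSimilarity δ : C(ℂ, ℂ)).comp (polyline (x :: l))⟩ : Curve ℂ) = _
  congr 1
  ext t
  exact PinTheShear.apply_polylineFrom_of_lineMap _ (gmSimilarity_lineMap δ) x l t

/-! ### Repeating vertices: bookkeeping -/

section Stay

variable {E : Type*}

/-- `stay` along a list of points (no `none`) is that list. [folklore] -/
theorem stay_map_some : ∀ (q : E) (l : List E), stay q (l.map some) = l
  | _, [] => rfl
  | q, r :: l => by rw [List.map_cons, Sketch.PortTransfer.stay_cons_some, stay_map_some r l]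

/-- `stay` rests during a run of `none`s. [folklore] -/
theorem stay_replicate_none_append (y : E) (T : List (Option E)) :
    ∀ k : ℕ, stay y (List.replicate k none ++ T) = List.replicate k y ++ stay y T
  | 0 => rfl
  | k + 1 => by
    rw [List.replicate_succ, List.cons_append, Sketch.PortTransfer.stay_cons_none,
      stay_replicate_none_append y T k, List.replicate_succ, List.cons_append]

/-- `reduceOption` of a list of points (no `none`) is that list. [folklore] -/
theorem reduceOption_map_some : ∀ l : List E, (l.map some).reduceOption = l
  | [] => rfl
  | r :: l => by rw [List.map_cons, List.reduceOption_cons_of_some, reduceOption_map_some l]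

variable {α : Type*} (pt : α → E) (len : α → ℕ)

/-- The optional-point list "move to `pt x`, then rest `len x - 1` times" along `A`. [folklore] -/
def blocks (A : List α) : List (Option E) :=
  A.flatMap fun x => some (pt x) :: List.replicate (len x - 1) none

/-- Its points are the `pt x`. [folklore] -/
theorem reduceOption_blocks : ∀ A : List α, (blocks pt len A).reduceOption = A.map pt
  | [] => rfl
  | x :: A => by
    rw [blocks, List.flatMap_cons, ← blocks, List.cons_append, List.reduceOption_cons_of_some,
      List.reduceOption_append, List.reduceOption_replicate_none, List.nil_append, List.map_cons,
      reduceOption_blocks A]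

/-- `stay` along it repeats each `pt x` exactly `len x` times (when `len x ≥ 1`). [folklore] -/
theorem stay_blocks (hlen : ∀ x, 1 ≤ len x) :
    ∀ (q : E) (A : List α), stay q (blocks pt len A) = A.flatMap fun x => List.replicate (len x) (pt x)
  | _, [] => rfl
  | q, x :: A => by
    rw [blocks, List.flatMap_cons, ← blocks, List.cons_append, Sketch.PortTransfer.stay_cons_some,
      stay_replicate_none_append, stay_blocks hlen (pt x) A, List.flatMap_cons, ← List.cons_append,
      ← List.replicate_succ, Nat.sub_add_cancel (hlen x)]

/-- A constant list is pairwise related to a mapped list as soon as the constant is related to every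
image. [folklore] -/
theorem forall₂_replicate_map {β γ : Type*} {R : E → β → Prop} (x : E) (g : γ → β) :
    ∀ l : List γ, (∀ y ∈ l, R x (g y)) → List.Forall₂ R (List.replicate l.length x) (l.map g)
  | [], _ => List.Forall₂.nil
  | y :: l, h => by
    rw [List.length_cons, List.replicate_succ, List.map_cons, List.forall₂_cons]
    exact ⟨h y List.mem_cons_self, forall₂_replicate_map x g l fun z hz => h z (List.mem_cons_of_mem _ hz)⟩

/-- Blockwise pairing: repeated points against mapped blocks. [folklore] -/
theorem forall₂_flatMap_replicate {β γ : Type*} {R : E → β → Prop} (blk : α → List γ) (g : γ → β) :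
    ∀ A : List α, (∀ x ∈ A, ∀ y ∈ blk x, R (pt x) (g y)) →
      List.Forall₂ R (A.flatMap fun x => List.replicate (blk x).length (pt x)) (A.flatMap fun x => (blk x).map g)
  | [], _ => List.Forall₂.nil
  | x :: A, h => by
    rw [List.flatMap_cons, List.flatMap_cons]
    exact List.rel_append (forall₂_replicate_map (pt x) g (blk x) (h x List.mem_cons_self))
      (forall₂_flatMap_replicate blk g A fun x' hx' => h x' (List.mem_cons_of_mem _ hx'))

end Stay

/-! ### Rhombi are small -/

/-- The side vector of a column has length `1`. [folklore] -/
theorem norm_colShift (Θ : ℤ → ℝ) (k : ℤ) : ‖colShift Θ k‖ = 1 := by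
  have h : colShift Θ k = ⟨Real.sin (Θ k), -Real.cos (Θ k)⟩ := by
    apply Complex.ext <;> simp [colShift, -Complex.ofReal_sin, -Complex.ofReal_cos]
  rw [h, Complex.norm_def, Complex.normSq_apply]
  dsimp only
  rw [neg_mul_neg, ← pow_two, ← pow_two, Real.sin_sq_add_cos_sq, Real.sqrt_one]

/-- **Two points of a closed rhombus are at distance `≤ 2`** (the rhombus lies in the unit ball about
its centre). [folklore] -/
theorem dist_le_two_of_mem_rhombus (Θ : ℤ → ℝ) (f : Face) {z w : ℂ} (hz : z ∈ rhombus Θ f) (hw : w ∈ rhombus Θ f) :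
    dist z w ≤ 2 := by
  set c₀ := planeCorner Θ f + (I + colShift Θ f.1) / 2 with hc₀
  have hI : ‖(I : ℂ)‖ = 1 := Complex.norm_I
  have hs := norm_colShift Θ f.1
  have hball : rhombus Θ f ⊆ Metric.closedBall c₀ 1 := by
    refine convexHull_min ?_ (convex_closedBall c₀ 1)
    intro p hp
    rw [Metric.mem_closedBall, dist_eq_norm, hc₀]
    simp only [cornerSet, mem_insert_iff, mem_singleton_iff] at hp
    have key : ∀ u v : ℂ, ‖u‖ = 1 → ‖v‖ = 1 → ‖u / 2 + v / 2‖ ≤ 1 ∧ ‖u / 2 - v / 2‖ ≤ 1 := by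
      intro u v hu hv
      have h1 : ‖u / 2‖ = 1 / 2 := by rw [norm_div, hu]; simp
      have h2 : ‖v / 2‖ = 1 / 2 := by rw [norm_div, hv]; simp
      constructor
      · calc ‖u / 2 + v / 2‖ ≤ ‖u / 2‖ + ‖v / 2‖ := norm_add_le _ _
          _ = 1 := by rw [h1, h2]; norm_num
      · calc ‖u / 2 - v / 2‖ ≤ ‖u / 2‖ + ‖v / 2‖ := norm_sub_le _ _
          _ = 1 := by rw [h1, h2]; norm_num
    rcases hp with rfl | rfl | rfl | rfl
    · have := (key _ _ hI hs).1
      rw [show planeCorner Θ f - (planeCorner Θ f + (I + colShift Θ f.1) / 2) = -(I / 2 + colShift Θ f.1 / 2) by ring,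
        norm_neg]; exact this
    · have := (key _ _ hI hs).2
      rw [show planeCorner Θ f + I - (planeCorner Θ f + (I + colShift Θ f.1) / 2) = I / 2 - colShift Θ f.1 / 2 by ring]
      exact this
    · have := (key _ _ hs hI).2
      rw [show planeCorner Θ f + colShift Θ f.1 - (planeCorner Θ f + (I + colShift Θ f.1) / 2) =
        colShift Θ f.1 / 2 - I / 2 by ring]
      exact this
    · have := (key _ _ hI hs).1
      rw [show planeCorner Θ f + I + colShift Θ f.1 - (planeCorner Θ f + (I + colShift Θ f.1) / 2) =
        I / 2 + colShift Θ f.1 / 2 by ring]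
      exact this
  calc dist z w ≤ dist z c₀ + dist c₀ w := dist_triangle _ _ _
    _ ≤ 1 + 1 := add_le_add (hball hz) (by rw [dist_comm]; exact hball hw)
    _ = 2 := by norm_num

/-- Two points of a rescaled closed rhombus are at distance `≤ 2δ` (`δ ≥ 0`). [folklore] -/
theorem dist_le_of_mem_image_rhombus {δ : ℝ} (hδ : 0 ≤ δ) (f : Face) {z w : ℂ}
    (hz : z ∈ (fun u : ℂ => (δ : ℂ) * u) '' rhombus third f) (hw : w ∈ (fun u : ℂ => (δ : ℂ) * u) '' rhombus third f) :
    dist z w ≤ 2 * δ := by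
  obtain ⟨z, hz, rfl⟩ := hz
  obtain ⟨w, hw, rfl⟩ := hw
  rw [dist_eq_norm, ← mul_sub, norm_mul, Complex.norm_real, Real.norm_of_nonneg hδ, ← dist_eq_norm, mul_comm]
  exact mul_le_mul_of_nonneg_right (dist_le_two_of_mem_rhombus third f hz hw) hδ

/-- **The `S_δ`-image of the rescaled centre of a triangle lies in its rescaled closed rhombus.**
[folklore] -/
theorem gmSimilarity_mul_hexCenter_mem (δ : ℝ) (v : HexVertex) :
    gmSimilarity δ ((δ : ℂ) * hexCenter v) ∈ (fun u : ℂ => (δ : ℂ) * u) '' rhombus third (gmFace v) := by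
  rw [← (gmSimilarity δ).symm.injective.mem_set_image, Homeomorph.symm_apply_apply, symm_image_rhombus,
    mul_hexCenter_eq_psi]
  exact mem_image_of_mem _ (openSq_subset_sq _ (sqPt_mem_openSq v))

/-! ### The two drawings of `φ γ` -/

/-- The rescaled midpoint of a mid-edge of `H(π/3)` (vertex of the Glazman–Manolescu drawing).
[cite: GlazmanManolescu2019, §1] -/
def gmPt (δ : ℝ) (e : MidEdge) : ℂ := (δ : ℂ) * planeMidpoint third e

/-- The `S_δ`-image of the rescaled centre of a triangle (vertex of the transported
Duminil-Copin–Smirnov drawing). [folklore] -/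
def hexPt (δ : ℝ) (v : HexVertex) : ℂ := gmSimilarity δ ((δ : ℂ) * hexCenter v)

section Curves

variable {Ω : Set ℂ} {δ : ℝ} (hδ : 0 < δ) {a b : MidEdge} (ha : IsBdryEdge (meshFaces third Ω δ) a)
  (hb : IsBdryEdge (meshFaces third Ω δ) b) (hab : a ≠ b)
include hδ

/-- **The Glazman–Manolescu drawing of `φ γ` with repeated vertices**: the class of the polyline of
`φ γ` is that of the polyline starting at the midpoint of `a` and repeating the exit midpoint of each
arc once per triangle crossed by the arc. [folklore] -/
theorem curve_hexToYB_eq (γ : HexDomainSAW (faceDomain Ω δ a) δ (bdryVertex (meshFaces third Ω δ) a)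
    (bdryVertex (meshFaces third Ω δ) b)) :
    (hexToYB hδ.ne' ha hb hab γ).curve third δ = CurveClass.mk ⟨polyline (gmPt δ a ::
      (arcsOf (hexToYB hδ.ne' ha hb hab γ).mids).flatMap fun p => List.replicate (arcTris p).length (gmPt δ p.2))⟩ := by
  have hA : (arcsOf (hexToYB hδ.ne' ha hb hab γ).mids).map Prod.snd = (hexToYB hδ.ne' ha hb hab γ).mids.tail :=
    List.map_snd_zip (by simp)
  have hlen : ∀ p : MidEdge × MidEdge, 1 ≤ (arcTris p).length := fun p =>
    Nat.one_le_iff_ne_zero.2 fun h => arcTris_ne_nil p (List.length_eq_zero_iff.1 h)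
  rw [← stay_blocks (fun p : MidEdge × MidEdge => gmPt δ p.2) (fun p => (arcTris p).length) hlen (gmPt δ a),
    mk_polyline_stay, reduceOption_blocks, show (fun p : MidEdge × MidEdge => gmPt δ p.2) = gmPt δ ∘ Prod.snd from rfl,
    ← List.map_map, hA]
  rfl

omit hδ in
/-- **The transported Duminil-Copin–Smirnov drawing of `γ` with the first vertex repeated.**
[folklore] -/
theorem map_curve_eq (γ : HexDomainSAW (faceDomain Ω δ a) δ (bdryVertex (meshFaces third Ω δ) a)
    (bdryVertex (meshFaces third Ω δ) b)) :
    CurveClass.map (gmSimilarity δ : C(ℂ, ℂ)) γ.curve =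
      CurveClass.mk ⟨polyline (hexPt δ (bdryVertex (meshFaces third Ω δ) a) :: γ.walk.support.map (hexPt δ))⟩ := by
  rw [EmbDomainSAW.curve, SimpleGraph.Walk.toCurve, ← γ.walk.cons_tail_support, List.map_cons, List.map_cons,
    map_gmSimilarity_mk_polyline]
  have hl : (((δ : ℂ) * hexCenter (bdryVertex (meshFaces third Ω δ) a)) ::
      γ.walk.support.tail.map fun v => (δ : ℂ) * hexCenter v).map (gmSimilarity δ) =
      hexPt δ (bdryVertex (meshFaces third Ω δ) a) :: γ.walk.support.tail.map (hexPt δ) := by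
    simp only [List.map_cons, List.map_map]
    rfl
  rw [hl]
  conv_lhs => rw [← reduceOption_map_some (γ.walk.support.tail.map (hexPt δ)), ← List.reduceOption_cons_of_none,
    ← mk_polyline_stay, Sketch.PortTransfer.stay_cons_none, stay_map_some]

/-- **The Glazman–Manolescu drawing of `φ γ` and the `S_δ`-image of the Duminil-Copin–Smirnov drawing
of `γ` are `2δ`-close** in `CurveClass ℂ`. [cite: GlazmanManolescu2019, §1 p. 3, Fig. 2] -/
theorem dist_curve_hexToYB_le (γ : HexDomainSAW (faceDomain Ω δ a) δ (bdryVertex (meshFaces third Ω δ) a)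
    (bdryVertex (meshFaces third Ω δ) b)) :
    dist ((hexToYB hδ.ne' ha hb hab γ).curve third δ) (CurveClass.map (gmSimilarity δ : C(ℂ, ℂ)) γ.curve) ≤ 2 * δ := by
  have hsupp : γ.walk.support.map (hexPt δ) = (listTris (hexToYB hδ.ne' ha hb hab γ).mids).map (hexPt δ ∘ chart.symm) := by
    rw [← YBWalk.hvInner_eq_listTris, hvInner_hexToYB, List.map_map]
    exact List.map_congr_left fun v _ => by simp
  rw [curve_hexToYB_eq hδ ha hb hab, map_curve_eq, hsupp, listTris, List.map_flatMap]
  refine dist_mk_polyline_le (by linarith) (List.Forall₂.cons ?_ (forall₂_flatMap_replicate _ arcTris _ _ ?_))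
  · -- the starting points: midpoint of `a` and centre of the boundary triangle, both in `inclFace a`
    obtain ⟨-, sa, hsa⟩ := ha.inclFace_spec
    refine dist_le_of_mem_image_rhombus hδ.le (inclFace (meshFaces third Ω δ) a) (mem_image_of_mem _ ?_) ?_
    · have h := planeMidpoint_side_mem_rhombus third (inclFace (meshFaces third Ω δ) a) sa
      rwa [hsa] at h
    · have h := gmSimilarity_mul_hexCenter_mem δ (bdryVertex (meshFaces third Ω δ) a)
      rwa [gmFace_bdryVertex] at h
  · -- along an arc: the exit midpoint and the triangle centres lie in the rhombus of the arc
    intro p hp u hu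
    obtain ⟨f, -, hf⟩ := (hexToYB hδ.ne' ha hb hab γ).arc_mem p hp
    refine dist_le_of_mem_image_rhombus hδ.le f (mem_image_of_mem _ (planeMidpoint_mem_rhombus_of_arcFace third hf).2) ?_
    have hface : gmFace (chart.symm u) = f := by
      rw [← faceHV_chart, RelIso.apply_symm_apply, faceHV_of_mem_arcTris hu, faceOf_eq hf]
    have h := gmSimilarity_mul_hexCenter_mem δ (chart.symm u)
    rwa [hface] at h

end Curves

/-- **Main statement of this file (registered sub-goal of `stub_gmHexDictionary`)**: the drawn curve of
`φ γ` is `2δ`-close to the `S_δ`-image of the drawn curve of `γ`. [cite: GlazmanManolescu2019, §1 p. 3, Fig. 2] -/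
theorem dist_curve_hexToYB_map_curve_le : ∀ {Ω : Set ℂ} {δ : ℝ} (hδ : 0 < δ) {a b : MidEdge} (ha : IsBdryEdge (meshFaces third Ω δ) a) (hb : IsBdryEdge (meshFaces third Ω δ) b) (hab : a ≠ b) (γ : HexDomainSAW (faceDomain Ω δ a) δ (bdryVertex (meshFaces third Ω δ) a) (bdryVertex (meshFaces third Ω δ) b)), dist ((hexToYB hδ.ne' ha hb hab γ).curve third δ) (CurveClass.map (gmSimilarity δ : C(ℂ, ℂ)) γ.curve) ≤ 2 * δ := by
  intro Ω δ hδ a b ha hb hab γ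
  exact dist_curve_hexToYB_le hδ ha hb hab γ

end Summit.CriticalPhenomena.SAWScalingLimit.Cruxes.HexTransfer.YbRelay

end
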